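import Literature.Analysis.FluidPDE.NSBoundedSuitableCauchy
import Literature.Analysis.FluidPDE.NSBoundedInteriorRegularity
import Literature.Analysis.FluidPDE.SuitableWeakPressure
import Literature.Analysis.FluidPDE.SolenoidalTruncation
import HarnessLib

/-!
# Bounded distributional Navier–Stokes solutions are in the energy class: proof of
# `NSBoundedEnergyClass`

Analysis/FluidPDE proof file discharging the named fact
`Literature.Analysis.FluidPDE.NSBoundedEnergyClass` (`FluidPDE/NSBoundedInteriorRegularity`;
Seregin–Šverák 2009, §2, arXiv:0804.1803 p. 6: a pair `(v, q)` solving the Navier–Stokes system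
in the sense of distributions with `v ∈ L_∞` and `q ∈ L_{3/2}` "is in fact a suitable weak
solution … It is certainly true in `B × ]-1,-a²[`", the suitable class of their Def. 2.2 being
`v ∈ L_{2,∞} ∩ W^{1,0}_2`; mechanism as in Seregin, *Lecture notes on regularity theory for the
Navier–Stokes equations* (2014), §6.3, proof of Prop. 3.9, Step 1, (6.3.1)–(6.3.2): mollify the
system, test the mollified momentum equation with `φ u_ϱ`, bound `∫∫ φ |∇u_ϱ|²` uniformly in `ϱ`).

The analytic core — the mollified gradients `D(kₙ ⋆ 𝟙_Ω u)`, truncated to a compact `K ⊆ Ω`,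
form a Cauchy sequence in `L²(ℝ × E)` and converge to some `G̃ ∈ L²` — is the accepted
`Literature.Analysis.FluidPDE.exists_L2_limit_mollifiedGradient` (`FluidPDE/NSBoundedSuitableCauchy`).
This file supplies the identification of the limit: since `kₙ ⋆ 𝟙_Ω u → 𝟙_Ω u` in `L¹` and the
classical integration by parts holds for each smooth `kₙ ⋆ 𝟙_Ω u`, the `L²`-limit `G̃` is a weak
spatial gradient of `u` on every open `Q' ⊆ K` (Evans, *PDE*, §5.2.1: weak derivatives are
stable under `L¹_loc` convergence of the functions and of the derivatives), and `|G̃|² ∈ L¹`.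
Specialised to centred parabolic cylinders this is `NSBoundedEnergyClass`.

## Main statements (all proved)

* `integral_fderiv_mul_inner_eq_neg_of_contDiff` — for a jointly smooth field `V` and a
  space–time test function `ψ`, `∫ ∂ᵥψ ⟪V, w⟫ = -∫ ψ ⟪DV v, w⟫` over `ℝ × E`;
* `hasWeakSpatialGradientOn_of_tendsto_mollifiedGradient` — identification of the `L²` limit
  of truncated gradients of smooth approximants as a weak spatial gradient;
* `exists_hasWeakSpatialGradientOn_of_bounded` — a bounded distributional solution on an open
  set `Ω` of finite measure with `p ∈ L^{3/2}(Ω)` has, on every open `Q'` contained in a compact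
  `K ⊆ Ω`, a weak spatial gradient `G` with `∫∫_{Q'} |G|² < ∞`;
* `NSBoundedEnergyClass_holds : NSBoundedEnergyClass`.

## References

* G. Seregin, V. Šverák, *On Type I singularities of the local axi-symmetric solutions of the
  Navier–Stokes equations*, Comm. PDE 34 (2009) = arXiv:0804.1803, §2 p. 6. [`SereginSverak2009`]
* G. Seregin, *Lecture notes on regularity theory for the Navier–Stokes equations* (World
  Scientific 2014), §6.3, proof of Prop. 3.9, Step 1. [`Seregin2014`]
* L. C. Evans, *Partial Differential Equations*, 2nd ed. (2010), §5.2.1, App. C.4.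
-/

noncomputable section

open MeasureTheory TopologicalSpace Set Function Filter Topology ContinuousLinearMap Metric
  InnerProductSpace Module
open scoped ENNReal NNReal Convolution RealInnerProductSpace

namespace Literature.Analysis.FluidPDE

section WeakGradientLimit

variable {E : Type*} [NormedAddCommGroup E] [InnerProductSpace ℝ E] [FiniteDimensional ℝ E]
  [MeasurableSpace E] [BorelSpace E]

/-- **Classical integration by parts in space, space–time form.** For a jointly `C^∞` field
`V` on `ℝ × E`, a space–time test function `ψ` and vectors `v, w`,
`∫ (∂ᵥψ) ⟪V, w⟫ = -∫ ψ ⟪(D V) v, w⟫`, both integrals over `ℝ × E` (slice-wise the `C¹` case of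
the weak-derivative identity, Evans, *PDE*, §5.2.1, then Fubini). [folklore] -/
theorem integral_fderiv_mul_inner_eq_neg_of_contDiff {V : ℝ → E → E}
    (hV : ContDiff ℝ (⊤ : ℕ∞) (uncurry V)) {Q : Opens (ℝ × E)} {ψ : ℝ → E → ℝ}
    (hψ : IsSpaceTimeTestOn Q ψ) (v w : E) :
    ∫ z : ℝ × E, fderiv ℝ (ψ z.1) z.2 v * ⟪V z.1 z.2, w⟫ =
      -∫ z : ℝ × E, ψ z.1 z.2 * ⟪fderiv ℝ (V z.1) z.2 v, w⟫ := by
  have hψ' : IsSpaceTimeTestOn (⊤ : Opens (ℝ × E)) ψ := hψ.mono le_top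
  have hθ : IsSpaceTimeTestOn (⊤ : Opens (ℝ × E)) (fun t x => fderiv ℝ (ψ t) x v) :=
    hψ'.fderiv_apply_top v
  -- smoothness of the slices and continuity of the slice derivative
  have hVt : ∀ t, ContDiff ℝ 1 (V t) := fun t =>
    (hV.comp (contDiff_prodMk_right t)).of_le one_le_infty
  have sV : IsSmoothSpaceTimeOn univ V := hV.contDiffOn
  have cV : Continuous (uncurry V) := hV.continuous
  have cDV : Continuous (uncurry fun s y => fderiv ℝ (V s) y) :=
    (sV.fderiv_slice uniqueDiffOn_univ).continuous_uncurry
  have cθ : Continuous (uncurry fun t x => fderiv ℝ (ψ t) x v) := hθ.contDiff.continuous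
  have cψ : Continuous (uncurry ψ) := hψ.contDiff.continuous
  -- the slice identity
  have hslice : ∀ t, ∫ x, fderiv ℝ (ψ t) x v * ⟪V t x, w⟫ =
      -∫ x, ψ t x * ⟪fderiv ℝ (V t) x v, w⟫ := by
    intro t
    have hWG : HasWeakGradient (V t) (fderiv ℝ (V t)) := hasWeakGradient_fderiv_of_contDiff (hVt t)
    have hψt : FunctionSpaces.IsTestFunctionOn (⊤ : Opens E) (ψ t) :=
      { contDiff := hψ'.contDiff_slice t
        hasCompactSupport := hψ'.hasCompactSupport_slice t
        tsupport_subset := fun _ _ => trivial }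
    have h := hWG.integral_fderiv_smul_eq (ψ t) v hψt
    simp only [Opens.coe_top, Measure.restrict_univ] at h
    have hψtc : HasCompactSupport (ψ t) := hψ'.hasCompactSupport_slice t
    have i1 : Integrable (fun x => fderiv ℝ (ψ t) x v • V t x) (volume : Measure E) := by
      refine Continuous.integrable_of_hasCompactSupport ?_ (hψtc.fderiv_apply (𝕜 := ℝ) v).smul_right
      exact (((hψ'.contDiff_slice t).continuous_fderiv (by simp)).clm_apply continuous_const).smul
        (hVt t).continuous
    have i2 : Integrable (fun x => ψ t x • fderiv ℝ (V t) x v) (volume : Measure E) := by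
      refine Continuous.integrable_of_hasCompactSupport ?_ hψtc.smul_right
      exact (hψ'.contDiff_slice t).continuous.smul
        (((hVt t).continuous_fderiv one_ne_zero).clm_apply continuous_const)
    have h' := congrArg (fun y : E => ⟪w, y⟫) h
    rw [← integral_inner i1 w, inner_neg_right, ← integral_inner i2 w] at h'
    simp only [real_inner_smul_right] at h'
    have e1 : (fun x => fderiv ℝ (ψ t) x v * ⟪V t x, w⟫) =
        fun x => fderiv ℝ (ψ t) x v * ⟪w, V t x⟫ := by
      funext x; rw [real_inner_comm w (V t x)]
    have e2 : (fun x => ψ t x * ⟪fderiv ℝ (V t) x v, w⟫) =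
        fun x => ψ t x * ⟪w, fderiv ℝ (V t) x v⟫ := by
      funext x; rw [real_inner_comm w (fderiv ℝ (V t) x v)]
    rw [e1, e2]
    exact h'
  -- integrability on the product
  have iL : Integrable (fun z : ℝ × E => fderiv ℝ (ψ z.1) z.2 v * ⟪V z.1 z.2, w⟫)
      ((volume : Measure ℝ).prod (volume : Measure E)) := by
    rw [← Measure.volume_eq_prod]
    refine Continuous.integrable_of_hasCompactSupport (cθ.mul (cV.inner continuous_const)) ?_
    exact hθ.hasCompactSupport.mul_right
  have iR : Integrable (fun z : ℝ × E => ψ z.1 z.2 * ⟪fderiv ℝ (V z.1) z.2 v, w⟫)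
      ((volume : Measure ℝ).prod (volume : Measure E)) := by
    rw [← Measure.volume_eq_prod]
    refine Continuous.integrable_of_hasCompactSupport
      (cψ.mul ((cDV.clm_apply continuous_const).inner continuous_const)) ?_
    exact hψ.hasCompactSupport.mul_right
  calc ∫ z : ℝ × E, fderiv ℝ (ψ z.1) z.2 v * ⟪V z.1 z.2, w⟫
      = ∫ t, ∫ x, fderiv ℝ (ψ t) x v * ⟪V t x, w⟫ := by
        rw [Measure.volume_eq_prod, integral_prod _ iL]
    _ = ∫ t, -∫ x, ψ t x * ⟪fderiv ℝ (V t) x v, w⟫ := by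
        refine integral_congr_ae (Eventually.of_forall fun t => hslice t)
    _ = -∫ t, ∫ x, ψ t x * ⟪fderiv ℝ (V t) x v, w⟫ := integral_neg _
    _ = -∫ z : ℝ × E, ψ z.1 z.2 * ⟪fderiv ℝ (V z.1) z.2 v, w⟫ := by
        rw [Measure.volume_eq_prod, integral_prod _ iR]

/-- **Identification of the `L²` limit of truncated gradients as a weak spatial gradient.** Let
`Vₙ` be jointly smooth fields on `ℝ × E`, integrable, converging in `L¹(ℝ × E)` to an integrable
`ũ` which agrees with the field `u` on the open set `Q'`; let `u` be locally integrable on `Q'`,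
`Q' ⊆ K` with `K` compact, and suppose the truncated slice gradients `𝟙_K D Vₙ` converge in
`L²(ℝ × E)` to some `G̃ ∈ L²`. Then `G̃` (curried) is a weak spatial gradient of `u` on `Q'`:
the classical identity `∫ ∂ᵥψ ⟪Vₙ, w⟫ = -∫ ψ ⟪DVₙ v, w⟫` passes to the limit on both sides
(Evans, *PDE*, §5.2.1). [folklore] -/
theorem hasWeakSpatialGradientOn_of_tendsto_mollifiedGradient {Q' : Opens (ℝ × E)}
    {u : ℝ → E → E} {ũ : ℝ × E → E} {V : ℕ → ℝ → E → E} {K : Set (ℝ × E)}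
    {Gt : ℝ × E → E →L[ℝ] E}
    (hu : LocallyIntegrableOn (uncurry u) (Q' : Set (ℝ × E)) volume)
    (hũu : ∀ z ∈ (Q' : Set (ℝ × E)), ũ z = u z.1 z.2)
    (hV : ∀ n, ContDiff ℝ (⊤ : ℕ∞) (uncurry (V n)))
    (hVi : ∀ n, Integrable (uncurry (V n)) (volume : Measure (ℝ × E)))
    (hũi : Integrable ũ (volume : Measure (ℝ × E)))
    (hVũ : Tendsto (fun n => eLpNorm (uncurry (V n) - ũ) 1 (volume : Measure (ℝ × E))) atTop (𝓝 0))
    (hK : IsCompact K) (hQ'K : (Q' : Set (ℝ × E)) ⊆ K) (hGt : MemLp Gt 2 (volume : Measure (ℝ × E)))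
    (hDG : Tendsto (fun n => eLpNorm (K.indicator (fun z : ℝ × E => fderiv ℝ (V n z.1) z.2) - Gt) 2
      (volume : Measure (ℝ × E))) atTop (𝓝 0)) :
    HasWeakSpatialGradientOn Q' u (fun t x => Gt (t, x)) := by
  have hKm : MeasurableSet K := hK.isClosed.measurableSet
  have hKfin : volume K < ∞ := hK.measure_lt_top
  set μK : Measure (ℝ × E) := volume.restrict K with hμK
  haveI : IsFiniteMeasure μK := isFiniteMeasure_restrict.2 hKfin.ne
  have hGtli : LocallyIntegrable Gt (volume : Measure (ℝ × E)) := hGt.locallyIntegrable one_le_two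
  set D : ℕ → ℝ × E → E →L[ℝ] E := fun n z => fderiv ℝ (V n z.1) z.2 with hD
  have hDc : ∀ n, Continuous (D n) := fun n => by
    have sV : IsSmoothSpaceTimeOn univ (V n) := (hV n).contDiffOn
    exact (sV.fderiv_slice uniqueDiffOn_univ).continuous_uncurry
  refine ⟨hu, ?_, fun ψ hψ v w => ?_⟩
  · have : uncurry (fun t x => Gt (t, x)) = Gt := by funext z; rfl
    rw [this]
    exact hGtli.locallyIntegrableOn _
  -- the data attached to the test function
  have hψ' : IsSpaceTimeTestOn (⊤ : Opens (ℝ × E)) ψ := hψ.mono le_top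
  have hθ : IsSpaceTimeTestOn (⊤ : Opens (ℝ × E)) (fun t x => fderiv ℝ (ψ t) x v) :=
    hψ'.fderiv_apply_top v
  set θ : ℝ × E → ℝ := fun z => fderiv ℝ (ψ z.1) z.2 v with hθdef
  set ψ' : ℝ × E → ℝ := uncurry ψ with hψ'def
  have cθ : Continuous θ := hθ.contDiff.continuous
  have cψ' : Continuous ψ' := hψ.contDiff.continuous
  have hθsupp : HasCompactSupport θ := hθ.hasCompactSupport
  have hψsupp : HasCompactSupport ψ' := hψ.hasCompactSupport
  have hKψ : tsupport ψ' ⊆ (Q' : Set (ℝ × E)) := hψ.tsupport_subset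
  have hθ0 : ∀ z, z ∉ tsupport ψ' → θ z = 0 := fun z hz => by
    have h := IsSpaceTimeTestOn.fderiv_slice_eq_zero_of_notMem (ψ := ψ) (t := z.1) (x := z.2) hz
    show fderiv ℝ (ψ z.1) z.2 v = 0
    rw [h]
    rfl
  have hψ0 : ∀ z, z ∉ tsupport ψ' → ψ' z = 0 := fun z hz => image_eq_zero_of_notMem_tsupport hz
  obtain ⟨Cθ, hCθ⟩ := cθ.bounded_above_of_compact_support hθsupp
  obtain ⟨Cψ, hCψ⟩ := cψ'.bounded_above_of_compact_support hψsupp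
  -- (1) the identity for each `n`
  have hIn : ∀ n, ∫ z : ℝ × E, θ z * ⟪V n z.1 z.2, w⟫ = -∫ z : ℝ × E, ψ' z * ⟪D n z v, w⟫ :=
    fun n => integral_fderiv_mul_inner_eq_neg_of_contDiff (hV n) hψ v w
  -- (2) the left-hand sides converge
  set wL : ℝ × E → E →L[ℝ] ℝ := fun z => θ z • innerSL ℝ w with hwL
  have mwL : AEStronglyMeasurable wL (volume : Measure (ℝ × E)) :=
    (cθ.smul continuous_const).aestronglyMeasurable
  have bwL : ∀ᵐ z ∂(volume : Measure (ℝ × E)), ‖wL z‖ ≤ Cθ * ‖w‖ := by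
    refine Eventually.of_forall fun z => ?_
    calc ‖wL z‖ = ‖θ z • innerSL ℝ w‖ := rfl
      _ ≤ ‖θ z‖ * ‖innerSL ℝ w‖ := norm_smul_le (θ z) (innerSL ℝ w)
      _ ≤ Cθ * ‖w‖ := mul_le_mul (hCθ z) (innerSL_apply_norm ℝ w).le (norm_nonneg (innerSL ℝ w))
          ((norm_nonneg _).trans (hCθ z))
  have hwL_apply : ∀ z (x : E), wL z x = θ z * ⟪x, w⟫ := fun z x => by
    show θ z • ⟪w, x⟫ = θ z * ⟪x, w⟫
    rw [smul_eq_mul, real_inner_comm]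
  have hL : Tendsto (fun n => ∫ z : ℝ × E, θ z * ⟪V n z.1 z.2, w⟫) atTop
      (𝓝 (∫ z : ℝ × E, θ z * ⟪ũ z, w⟫)) := by
    have h := tendsto_setIntegral_clm_apply_of_tendsto_eLpNorm_one' (μ := (volume : Measure (ℝ × E)))
      (Φ := fun n => uncurry (V n)) (Φ₀ := ũ) mwL bwL hVi hũi hVũ univ
    simp only [Measure.restrict_univ, hwL_apply] at h
    exact h
  -- (3) the right-hand sides converge
  have hDint : ∀ n, Integrable (D n) μK := fun n =>
    (hDc n).continuousOn.integrableOn_compact hK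
  have hGtK : Integrable Gt μK := (hGt.restrict K).integrable one_le_two
  have hDG1 : Tendsto (fun n => eLpNorm (D n - Gt) 1 μK) atTop (𝓝 0) := by
    have h2 : Tendsto (fun n => eLpNorm (D n - Gt) 2 μK) atTop (𝓝 0) := by
      refine tendsto_of_tendsto_of_tendsto_of_le_of_le tendsto_const_nhds hDG (fun n => zero_le)
        fun n => ?_
      calc eLpNorm (D n - Gt) 2 μK = eLpNorm (K.indicator (D n) - Gt) 2 μK := by
            refine eLpNorm_congr_ae ?_
            exact ((indicator_ae_eq_restrict hKm).symm.sub (ae_eq_refl _))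
        _ ≤ eLpNorm (K.indicator (D n) - Gt) 2 volume := eLpNorm_mono_measure _ Measure.restrict_le_self
    have hle : ∀ n, eLpNorm (D n - Gt) 1 μK ≤
        eLpNorm (D n - Gt) 2 μK * μK univ ^ (1 / (1 : ℝ≥0∞).toReal - 1 / (2 : ℝ≥0∞).toReal) :=
      fun n => eLpNorm_le_eLpNorm_mul_rpow_measure_univ (by norm_num)
        ((hDint n).1.sub hGtK.1)
    have hfin : μK univ ^ (1 / (1 : ℝ≥0∞).toReal - 1 / (2 : ℝ≥0∞).toReal) ≠ ∞ :=
      ENNReal.rpow_ne_top_of_nonneg (by norm_num) (measure_ne_top μK univ)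
    have h3 := ENNReal.Tendsto.mul_const h2 (Or.inr hfin)
    rw [zero_mul] at h3
    exact tendsto_of_tendsto_of_tendsto_of_le_of_le tendsto_const_nhds h3 (fun n => zero_le) hle
  set ℓ : (E →L[ℝ] E) →L[ℝ] ℝ := (innerSL ℝ w).comp (ContinuousLinearMap.apply ℝ E v) with hℓ
  have hℓ_apply : ∀ A : E →L[ℝ] E, ℓ A = ⟪A v, w⟫ := fun A => by
    show ⟪w, A v⟫ = ⟪A v, w⟫
    exact real_inner_comm _ _
  set wR : ℝ × E → (E →L[ℝ] E) →L[ℝ] ℝ := fun z => ψ' z • ℓ with hwR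
  have mwR : AEStronglyMeasurable wR μK := (cψ'.smul continuous_const).aestronglyMeasurable
  have bwR : ∀ᵐ z ∂μK, ‖wR z‖ ≤ Cψ * ‖ℓ‖ := by
    refine Eventually.of_forall fun z => ?_
    calc ‖wR z‖ = ‖ψ' z • ℓ‖ := rfl
      _ ≤ ‖ψ' z‖ * ‖ℓ‖ := ContinuousLinearMap.opNorm_smul_le (ψ' z) ℓ
      _ ≤ Cψ * ‖ℓ‖ := mul_le_mul_of_nonneg_right (hCψ z) (norm_nonneg ℓ)
  have hwR_apply : ∀ z (A : E →L[ℝ] E), wR z A = ψ' z * ⟪A v, w⟫ := fun z A => by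
    show ψ' z • ℓ A = ψ' z * ⟪A v, w⟫
    rw [hℓ_apply, smul_eq_mul]
  have hR : Tendsto (fun n => ∫ z in K, ψ' z * ⟪D n z v, w⟫) atTop
      (𝓝 (∫ z in K, ψ' z * ⟪Gt z v, w⟫)) := by
    have h := tendsto_setIntegral_clm_apply_of_tendsto_eLpNorm_one' (μ := μK)
      (Φ := D) (Φ₀ := Gt) mwR bwR hDint hGtK hDG1 univ
    simp only [Measure.restrict_univ, hwR_apply] at h
    exact h
  -- the right-hand sides as whole-space integrals
  have hoffK : ∀ (F : ℝ × E → E →L[ℝ] E), ∀ z, z ∉ K → ψ' z * ⟪F z v, w⟫ = 0 := fun F z hz => by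
    rw [hψ0 z (fun h => hz (hQ'K (hKψ h))), zero_mul]
  have hRK : ∀ n, ∫ z : ℝ × E, ψ' z * ⟪D n z v, w⟫ = ∫ z in K, ψ' z * ⟪D n z v, w⟫ := fun n =>
    (setIntegral_eq_integral_of_forall_compl_eq_zero (hoffK (D n))).symm
  -- (4) the limit identity in product form
  have hlim : ∫ z : ℝ × E, θ z * ⟪ũ z, w⟫ = -∫ z in K, ψ' z * ⟪Gt z v, w⟫ := by
    have h1 : Tendsto (fun n => ∫ z : ℝ × E, θ z * ⟪V n z.1 z.2, w⟫) atTop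
        (𝓝 (-∫ z in K, ψ' z * ⟪Gt z v, w⟫)) := by
      refine hR.neg.congr fun n => ?_
      rw [hIn n, hRK n]
    exact tendsto_nhds_unique hL h1
  -- (5) conversion to iterated integrals
  have hLeq : ∫ z : ℝ × E, θ z * ⟪ũ z, w⟫ = ∫ t, ∫ x, fderiv ℝ (ψ t) x v * ⟪u t x, w⟫ := by
    have hpt : ∀ z : ℝ × E, θ z * ⟪ũ z, w⟫ = θ z * ⟪u z.1 z.2, w⟫ := fun z => by
      by_cases hz : z ∈ tsupport ψ'
      · rw [hũu z (hKψ hz)]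
      · rw [hθ0 z hz, zero_mul, zero_mul]
    simp_rw [hpt]
    have hint : Integrable (fun z : ℝ × E => θ z * ⟪u z.1 z.2, w⟫)
        ((volume : Measure ℝ).prod (volume : Measure E)) := by
      rw [← Measure.volume_eq_prod]
      have h := integrable_inner_of_locallyIntegrableOn hu (w := fun z => θ z • w)
        (cθ.smul continuous_const) (hψsupp.isCompact) hKψ
        (fun z hz => by rw [hθ0 z hz, zero_smul])
      refine h.congr (Eventually.of_forall fun z => ?_)
      simp only [real_inner_smul_right, mul_comm]
    rw [Measure.volume_eq_prod, integral_prod _ hint]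
  have hReq : ∫ z in K, ψ' z * ⟪Gt z v, w⟫ = ∫ t, ∫ x, ψ t x * ⟪Gt (t, x) v, w⟫ := by
    rw [setIntegral_eq_integral_of_forall_compl_eq_zero (hoffK Gt)]
    have hint : Integrable (fun z : ℝ × E => ψ' z * ⟪Gt z v, w⟫)
        ((volume : Measure ℝ).prod (volume : Measure E)) := by
      rw [← Measure.volume_eq_prod]
      have h := ℓ.integrable_comp (hGtli.integrable_smul_left_of_hasCompactSupport cψ' hψsupp)
      refine h.congr (Eventually.of_forall fun z => ?_)
      show ℓ (ψ' z • Gt z) = ψ' z * ⟪Gt z v, w⟫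
      rw [map_smul, hℓ_apply, smul_eq_mul]
    rw [Measure.volume_eq_prod, integral_prod _ hint]
    rfl
  calc ∫ t, ∫ x, fderiv ℝ (ψ t) x v * ⟪u t x, w⟫ = ∫ z : ℝ × E, θ z * ⟪ũ z, w⟫ := hLeq.symm
    _ = -∫ z in K, ψ' z * ⟪Gt z v, w⟫ := hlim
    _ = -∫ t, ∫ x, ψ t x * ⟪Gt (t, x) v, w⟫ := by rw [hReq]

end WeakGradientLimit

/-! ### Bounded distributional solutions have a square-integrable weak spatial gradient -/

section Bounded

variable {E : Type*} [NormedAddCommGroup E] [InnerProductSpace ℝ E] [FiniteDimensional ℝ E]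
  [MeasurableSpace E] [BorelSpace E]

/-- **Bounded distributional solutions are in `W^{1,0}_{2,loc}`** (the `∇v ∈ L₂` half of
Seregin–Šverák 2009, §2 p. 6: a pair with (b8)–(b10) "is in fact a suitable weak solution … It
is certainly true in `B × ]-1,-a²[`"; mechanism Seregin 2014, §6.3, proof of Prop. 3.9, Step 1).
Let `(u, p)` solve the unforced Navier–Stokes system (viscosity `ν > 0`) in the sense of
distributions on an open `Ω ⊆ ℝ × E` of finite measure, with `‖u‖ ≤ M` a.e. on `Ω` and
`p ∈ L^{3/2}(Ω)`. Then for every compact `K ⊆ Ω` and every open `Q' ⊆ K` there is a weak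
spatial gradient `G` of `u` on `Q'` with `∫∫_{Q'} |G|² < ∞`: the `L²` limit of the truncated
mollified gradients (`exists_L2_limit_mollifiedGradient`), identified by
`hasWeakSpatialGradientOn_of_tendsto_mollifiedGradient`. [cite: SereginSverak2009, §2 p. 6 (with Remark 3.4); mechanism Seregin2014 §6.3, proof of Prop. 3.9, Step 1] -/
theorem exists_hasWeakSpatialGradientOn_of_bounded {ν : ℝ} (hν : 0 < ν)
    {Ω : Opens (ℝ × E)} {u : ℝ → E → E} {p : ℝ → E → ℝ}
    (hNS : IsDistributionalNSSolutionOn Ω ν 0 u p)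
    (hΩ : volume (Ω : Set (ℝ × E)) < ∞)
    {M : ℝ} (hM : ∀ᵐ z ∂(volume.restrict (Ω : Set (ℝ × E))), ‖u z.1 z.2‖ ≤ M)
    (hp : ∫⁻ z in (Ω : Set (ℝ × E)), ‖p z.1 z.2‖ₑ ^ (3 / 2 : ℝ) < ∞)
    {K : Set (ℝ × E)} (hK : IsCompact K) (hKΩ : K ⊆ (Ω : Set (ℝ × E)))
    {Q' : Opens (ℝ × E)} (hQ'K : (Q' : Set (ℝ × E)) ⊆ K) :
    ∃ G : ℝ → E → E →L[ℝ] E, HasWeakSpatialGradientOn Q' u G ∧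
      ∫⁻ z in (Q' : Set (ℝ × E)), ENNReal.ofReal (frobeniusNormSq (G z.1 z.2)) < ∞ := by
  haveI : (volume : Measure (ℝ × E)).IsAddHaarMeasure := Measure.prod.instIsAddHaarMeasure _ _
  have hQm : MeasurableSet (Ω : Set (ℝ × E)) := Ω.isOpen.measurableSet
  haveI : IsFiniteMeasure (volume.restrict (Ω : Set (ℝ × E))) :=
    ⟨by rwa [Measure.restrict_apply_univ]⟩
  -- the classes of `u` on `Ω` and of its zero extension
  have hvm : AEStronglyMeasurable (uncurry u) (volume.restrict (Ω : Set (ℝ × E))) :=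
    hNS.1.aestronglyMeasurable
  have huinf : MemLp (uncurry u) ∞ (volume.restrict (Ω : Set (ℝ × E))) :=
    memLp_top_of_bound hvm M hM
  have hu1Q : MemLp (uncurry u) 1 (volume.restrict (Ω : Set (ℝ × E))) := huinf.mono_exponent le_top
  have huI : IntegrableOn (uncurry u) (Ω : Set (ℝ × E)) volume := memLp_one_iff_integrable.1 hu1Q
  set ũ : ℝ × E → E := zeroExt Ω u with hũ
  have hũi : Integrable ũ (volume : Measure (ℝ × E)) := integrable_zeroExt huI
  have hũ1 : MemLp ũ 1 (volume : Measure (ℝ × E)) := memLp_one_iff_integrable.2 hũi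
  have hũli : LocallyIntegrable ũ volume := hũi.locallyIntegrable
  have hũu : ∀ z ∈ (Q' : Set (ℝ × E)), ũ z = u z.1 z.2 := fun z hz =>
    zeroExt_of_mem u (hKΩ (hQ'K hz))
  -- the mollifiers and the mollified velocities
  obtain ⟨bump, hbr, -⟩ := FunctionSpaces.exists_contDiffBump_seq (E := ℝ × E)
  set k : ℕ → ℝ × E → ℝ := fun n => (bump n).normed volume with hk
  have hkinf : ∀ n, ContDiff ℝ (⊤ : ℕ∞) (k n) := fun n => (bump n).contDiff_normed
  have hkc : ∀ n, HasCompactSupport (k n) := fun n => (bump n).hasCompactSupport_normed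
  set V : ℕ → ℝ → E → E := fun n => stMollify (k n) ũ with hV
  have hVsm : ∀ n, ContDiff ℝ (⊤ : ℕ∞) (uncurry (V n)) := fun n =>
    contDiff_uncurry_stMollify (hkinf n) (hkc n) hũli
  have mV1 : ∀ n, MemLp (uncurry (V n)) 1 volume := fun n =>
    UnboundedOperators.memLp_convolution_lsmul (bump n).integrable_normed hũ1 le_rfl
  have hVi : ∀ n, Integrable (uncurry (V n)) (volume : Measure (ℝ × E)) := fun n =>
    memLp_one_iff_integrable.1 (mV1 n)
  have cV1 : Tendsto (fun n => eLpNorm (uncurry (V n) - ũ) 1 volume) atTop (𝓝 0) :=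
    FunctionSpaces.tendsto_eLpNorm_normed_convolution_sub_self hbr le_rfl ENNReal.one_ne_top hũ1
  -- the `L²` limit of the truncated mollified gradients
  obtain ⟨Gt, hGt, hDG⟩ := exists_L2_limit_mollifiedGradient hν hNS hΩ hM hp hbr hK hKΩ
  refine ⟨fun t x => Gt (t, x), ?_, ?_⟩
  · exact hasWeakSpatialGradientOn_of_tendsto_mollifiedGradient
      (hNS.1.mono_set (hQ'K.trans hKΩ)) hũu hVsm hVi hũi cV1 hK hQ'K hGt hDG
  · -- `∫∫_{Q'} |G̃|² ≤ (dim E) ‖G̃‖²_{L²} < ∞`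
    calc ∫⁻ z in (Q' : Set (ℝ × E)), ENNReal.ofReal (frobeniusNormSq (Gt (z.1, z.2)))
        ≤ ∫⁻ z, ENNReal.ofReal (frobeniusNormSq (Gt z)) := setLIntegral_le_lintegral _ _
      _ ≤ ∫⁻ z, (finrank ℝ E : ℝ≥0∞) * ‖Gt z‖ₑ ^ 2 :=
          lintegral_mono fun z => ofReal_frobeniusNormSq_le_finrank_mul (Gt z)
      _ = (finrank ℝ E : ℝ≥0∞) * eLpNorm Gt 2 volume ^ 2 := by
          rw [lintegral_const_mul' _ _ (ENNReal.natCast_ne_top _),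
            MollifiedLimits.eLpNorm_two_pow_two]
      _ < ∞ := ENNReal.mul_lt_top (ENNReal.natCast_lt_top _)
          (ENNReal.pow_lt_top hGt.eLpNorm_lt_top)

end Bounded

/-! ### The named fact -/

section Fact

/-- The closed cylinder `[t - r², t + r²] × B̄(x, r)` lies inside the centred parabolic cylinder
`Q*_R(t, x)` when `0 ≤ r < R`. [folklore] -/
theorem Icc_prod_closedBall_subset_parabolicCylinderCentered {X : Type*} [PseudoMetricSpace X]
    {r R : ℝ} (hr : 0 ≤ r) (hrR : r < R) (z : ℝ × X) :
    Icc (z.1 - r ^ 2) (z.1 + r ^ 2) ×ˢ closedBall z.2 r ⊆ parabolicCylinderCentered R z := by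
  have h2 : r ^ 2 < R ^ 2 := by nlinarith
  rintro w ⟨⟨h1, h1'⟩, hw⟩
  rw [mem_parabolicCylinderCentered]
  exact ⟨⟨by linarith, by linarith⟩, (mem_closedBall.1 hw).trans_lt hrR⟩

/-- **Discharge of `NSBoundedEnergyClass`** (Seregin–Šverák 2009, §2 p. 6; mechanism Seregin
2014, §6.3, proof of Prop. 3.9, Step 1): on the centred cylinder `Q*_R(z)`, of finite measure,
a bounded distributional solution with `L_{3/2}` pressure has on each `Q*_r(z)`, `0 < r < R`
(contained in the compact `[t - r², t + r²] × B̄(x, r) ⊆ Q*_R(z)`), a weak spatial gradient with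
square-integrable Frobenius norm, by `exists_hasWeakSpatialGradientOn_of_bounded`.
[cite: SereginSverak2009, §2 p. 6 (suitability of pairs with (b8)–(b10) in B × ]-1,-a²[); mechanism Seregin2014 §6.3 proof of Prop. 3.9, Step 1] -/
theorem NSBoundedEnergyClass_holds : NSBoundedEnergyClass := by
  intro u p z R M hsol hbd hp r hr
  obtain ⟨hr0, hrR⟩ := hr
  set K : Set (ℝ × EuclideanSpace ℝ (Fin 3)) :=
    Icc (z.1 - r ^ 2) (z.1 + r ^ 2) ×ˢ closedBall z.2 r with hK
  have hKc : IsCompact K := isCompact_Icc.prod (isCompact_closedBall _ _)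
  have hKΩ : K ⊆ parabolicCylinderCentered R z :=
    Icc_prod_closedBall_subset_parabolicCylinderCentered hr0.le hrR z
  have hQ'K : parabolicCylinderCentered r z ⊆ K :=
    prod_mono Ioo_subset_Icc_self ball_subset_closedBall
  have hΩ : volume (parabolicCylinderCentered R z) < ∞ := by
    rw [parabolicCylinderCentered, Measure.volume_eq_prod, Measure.prod_prod]
    exact ENNReal.mul_lt_top measure_Ioo_lt_top measure_ball_lt_top
  obtain ⟨G, hG, hG2⟩ := exists_hasWeakSpatialGradientOn_of_bounded
    (Ω := parabolicCylinderCenteredOpens R z) (Q' := parabolicCylinderCenteredOpens r z)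
    one_pos hsol hΩ hbd hp hKc hKΩ hQ'K
  exact ⟨G, hG, hG2⟩

end Fact

end Literature.Analysis.FluidPDE
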